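import Summits.NavierStokesRegularity.FluidComputer.CriticalFloor
import HarnessLib

/-!
# Fluid computer — the CRITICAL FACE of the level dictionary, IIb: Kato's floor AT THE DATUM (L28, datum form)

HONEST FRAMING (cell `pub-fluidc`, verbatim): *low prior, high value-of-information experiment on Tao's
machine paradigm; NOT a claim that NS blows up.* Theorem side of the cell; nothing here is evidence of blow-up.
`CriticalFloor.eLpNorm_three_floor` (L28) gives Kato's floor `δ ν < ‖u(t)‖_{L³}` at every INTERIOR instant
`t ∈ (0, T)` of a maximal smooth Leray–Hopf solution; `t = 0` is excluded there because the datum of the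
dictionary's class need not be bounded, so the classical solution need not lie in Serrin's class near `t = 0`.
This module closes that gap for BOUNDED data — the case of every designed field of the cell — with the SAME
constant:

* `hasSmoothExtensionPast_of_kato_of_bound` — the continuation step of `CriticalFloor` with its two interior
  inputs (restart of `u(· + t₀)` from `u(t₀)` on every window, boundedness of `u` on `[t₀, T₂] × ℝ³`) turned into
  hypotheses, so that `t₀ = 0` is allowed;
* `exists_bound_Icc_of_datum_bound` — a classical Leray–Hopf solution with bounded datum is bounded on every
  closed sub-strip `[0, T₂] × ℝ³`, `T₂ < T`: the EARLY WINDOW `‖u(t, x)‖ ≤ 2B₀` for `t < c₀ν/B₀²`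
  (`exists_earlyWindow_norm_le`, Kato–Oseen for bounded data + weak–strong uniqueness, PROVED in the tree) and
  interior boundedness beyond it (`LeraySupClock.exists_bound_window`);
* `eLpNorm_three_floor'` (**L28 WITH THE DATUM CLAUSE**): ONE absolute `δ > 0` (Kato's) such that along every
  maximal smooth Leray–Hopf solution of the unforced system (`ν > 0`): `δ ν < ‖u(t)‖_{L³}` for every
  `t ∈ (0, T)`, AND `δ ν < ‖u(0)‖_{L³}` whenever the datum `u(0)` is bounded. Read for the cell: the FIRST test
  a blow-up candidate `(ν, u₀)` must pass is at the data level — `‖u₀‖_{L³} > δ ν`; smallness in the critical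
  space is excluded before any dynamics (companion, in the dictionary's symmetry-free class, of the route
  CertifiedBlowup's `eLpNorm_three_datum_gt_of_isMaximalSmoothSolution` for rapidly decaying axisymmetric data).

Scale-invariant; necessity only; `δ` inexplicit. 0 sorry; no new definitions, no named facts.

## References

* T. Kato, Math. Z. 187 (1984) 471–480, Thms. 1, 2 and 4. [Kato1984MathZ]
* P. G. Lemarié-Rieusset, *The Navier–Stokes Problem in the 21st Century*, CRC 2016, Thm. 5.1, §9.9, Thm. 7.5,
  Thm. 15.1. [LemarieRieusset2016]
* L. Escauriaza, G. Seregin, V. Šverák, Russ. Math. Surveys 58:2 (2003), Thm. 7.4 and Remark 7.5.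
  [EscauriazaSereginSverak2003]
* Y. Giga, J. Differential Equations 62 (1986) 186–212, Thm. 4. [Giga1986]
-/

noncomputable section

open MeasureTheory Set Function Filter Topology Metric
open scoped ENNReal NNReal
open Literature.Analysis.FluidPDE Literature.Analysis.FunctionSpaces
open Summit.NavierStokesRegularity.FluidComputer.LerayClock
open Summit.NavierStokesRegularity.FluidComputer.LeraySupClock

namespace Summit.NavierStokesRegularity.FluidComputer.CriticalDatumFloor

/-! ## The continuation step from a possibly initial time -/

/-- **The continuation step of the critical floor, from any `t₀ ∈ [0, T)`.** Let `(u, p)` be a classical solution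
of the unforced Navier–Stokes system on `ℝ³ × [0, T)` (`ν > 0`), Leray–Hopf from `u 0`; let `t₀ ∈ [0, T)` be such
that `u(· + t₀)` is Leray–Hopf from `u(t₀)` on every window `[0, T₂ − t₀)`, `T₂ < T`, and `u` is bounded on every
`[t₀, T₂] × ℝ³`, `T₂ < T`. If `u(t₀)` launches a GLOBAL Kato solution `v` (mild, `C([0,∞); L³)`, `v(0) = u(t₀)`,
measurable) with Kato's smoothing bound `‖v(s)‖_∞ ≤ C/√s`, then `u` extends classically past `T` — the argument
of `CriticalFloor.hasSmoothExtensionPast_of_kato` verbatim (Kato ⇒ Leray–Hopf, weak–strong uniqueness with the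
bounded classical translate as the Serrin member, classical representative of `v`, gluing), its two interior
inputs now hypotheses. [cite: Kato1984MathZ, Thm. 4] [cite: EscauriazaSereginSverak2003, Thm. 7.4 with Remark 7.5]
[cite: Giga1986, Thm. 4] -/
theorem hasSmoothExtensionPast_of_kato_of_bound {ν T : ℝ} (hν : 0 < ν)
    {u : ℝ → EuclideanSpace ℝ (Fin 3) → EuclideanSpace ℝ (Fin 3)} {p : ℝ → EuclideanSpace ℝ (Fin 3) → ℝ}
    (hcl : IsClassicalNSSolutionOn (Ico 0 T) ν 0 u p) (hLH : IsLerayHopfOn T ν 0 (u 0) u)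
    {t₀ : ℝ} (ht₀ : t₀ ∈ Ico 0 T)
    (hrestart : ∀ T₂ ∈ Ioo t₀ T, IsLerayHopfOn (T₂ - t₀) ν 0 (u t₀) (fun s => u (s + t₀)))
    (hbd : ∀ T₂ ∈ Ioo t₀ T, ∃ M : ℝ, ∀ t ∈ Icc t₀ T₂, ∀ x, ‖u t x‖ ≤ M)
    {v : ℝ → EuclideanSpace ℝ (Fin 3) → EuclideanSpace ℝ (Fin 3)}
    (hv : IsGlobalMildSolution ν 0 (u t₀) v) (hvc : ContinuousInLpOn (Ici 0) 3 v) (hv0 : v 0 = u t₀)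
    (hvm : AEStronglyMeasurable (uncurry v) (volume.restrict (Ioi 0 ×ˢ univ)))
    {C : ℝ} (hinf : ∀ s : ℝ, 0 < s → eLpNorm (v s) ∞ volume ≤ ENNReal.ofReal (C / Real.sqrt s)) :
    HasSmoothExtensionPast ν 0 u T := by
  -- the Kato solution on `[0, T₀)`, `T₀ = T - t₀ + 1`
  set T₀ : ℝ := T - t₀ + 1 with hT₀
  have hT₀pos : 0 < T₀ := by rw [hT₀]; linarith [ht₀.2]
  have hK : IsKatoSolutionOn T₀ ν (u t₀) v :=
    ⟨hv.mono Ico_subset_Ici_self, hvc.mono Ico_subset_Ici_self, hv0,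
      hvm.mono_measure (Measure.restrict_mono (prod_mono Ioo_subset_Ioi_self subset_rfl) le_rfl)⟩
  have hinf' : ∀ s ∈ Ioo 0 T₀, eLpNorm (v s) ∞ volume ≤ ENNReal.ofReal (C / Real.sqrt s) :=
    fun s hs => hinf s hs.1
  -- the datum `u t₀ ∈ L² ∩ L³`, weakly divergence free
  have hu2 : MemLp (u t₀) 2 volume := hLH.memLp t₀ ⟨ht₀.1, ht₀.2.le⟩
  have hu3 : MemLp (u t₀) 3 volume := hK.memLp_initial hT₀pos
  have hdiv : IsWeaklyDivFree (u t₀) := hK.isWeaklyDivFree_initial hT₀pos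
  -- the classical representative `(w, π)` of `v` on `(0, T₀)`
  obtain ⟨w, π, hwπ, hwv⟩ := mild_L3_smooth_holds hν hT₀pos hu3 hdiv hK.mild hK.continuousInLpOn
    hK.aestronglyMeasurable
  -- everywhere agreement `u t' = w (t' - t₀)` on `(t₀, T)`
  have heq : ∀ t' ∈ Ioo t₀ T, u t' = w (t' + -t₀) := by
    intro t' ht'
    have hT₂ : (t' + T) / 2 ∈ Ioo t₀ T := ⟨by linarith [ht'.1, ht'.2], by linarith [ht'.2]⟩
    set T' : ℝ := (t' + T) / 2 - t₀ with hT'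
    have hT'pos : 0 < T' := by rw [hT']; linarith [hT₂.1]
    have hT'T₀ : T' < T₀ := by rw [hT', hT₀]; linarith [hT₂.2]
    have hLHu : IsLerayHopfOn T' ν 0 (u t₀) (fun s => u (s + t₀)) := hrestart _ hT₂
    obtain ⟨M, hM⟩ := hbd _ hT₂
    have hS : MemLqLp ∞ ∞ (fun s => u (s + t₀)) (Ioo 0 T') :=
      memLqLp_top_top_of_bound (fun s hs => (hLHu.memLp s hs).1)
        (fun s hs x => hM (s + t₀) ⟨by linarith [hs.1], by rw [hT'] at hs; linarith [hs.2]⟩ x)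
    have hLHv : IsLerayHopfOn T' ν 0 (u t₀) v := (hK.isLerayHopfOn_of_memLp_two hν hu2 hinf' hT'T₀ hT'pos).1
    have hae : ∀ s ∈ Ioc 0 T', v s =ᵐ[volume] (fun s => u (s + t₀)) s :=
      serrin_weak_strong_uniqueness_holds hν hT'pos hLHu hu2 (q := ∞) (r := ∞) (by simp) (by simp) hS hLHv
    have hts : t' - t₀ ∈ Ioc 0 T' := ⟨sub_pos.2 ht'.1, by rw [hT']; linarith [hT₂.1, ht'.2]⟩
    have h1 : v (t' - t₀) =ᵐ[volume] u t' := by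
      have h := hae (t' - t₀) hts
      simpa only [sub_add_cancel] using h
    have h2 : w (t' - t₀) =ᵐ[volume] v (t' - t₀) := hwv (t' - t₀) ⟨hts.1, hts.2.trans_lt hT'T₀⟩
    have hcu : Continuous (u t') := (hcl.contDiff_velocity ⟨ht₀.1.trans ht'.1.le, ht'.2⟩).continuous
    have hcw : Continuous (w (t' - t₀)) := (hwπ.contDiff_velocity ⟨hts.1, hts.2.trans_lt hT'T₀⟩).continuous
    rw [← sub_eq_add_neg]
    exact (Continuous.ae_eq_iff_eq volume hcu hcw).1 (h2.trans h1).symm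
  -- the continuation piece `(w, π)(· - t₀)` on `(t₀, t₀ + T₀)`
  have h₂ : IsClassicalNSSolutionOn (Ioo t₀ (t₀ + T₀)) ν 0 (fun s => w (s + -t₀)) (fun s => π (s + -t₀)) := by
    have hwπ' := hwπ.comp_add_right (-t₀)
    have h0 : (fun s => (0 : ℝ → EuclideanSpace ℝ (Fin 3) → EuclideanSpace ℝ (Fin 3)) (s + -t₀)) = 0 := rfl
    rw [h0] at hwπ'
    exact hwπ'.mono (fun s hs => ⟨by simp only [mem_Ioo] at hs ⊢; linarith [hs.1],
      by simp only [mem_Ioo] at hs ⊢; linarith [hs.2]⟩) isOpen_Ioo.uniqueDiffOn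
  have hTT₀ : T < t₀ + T₀ := by rw [hT₀]; linarith
  exact ⟨t₀ + T₀, hTT₀, _, _, hcl.glue h₂ ht₀.1 ht₀.2 hTT₀.le heq, fun s hs => by simp only [if_pos hs.2]⟩

/-! ## A bounded datum keeps the solution bounded on every closed sub-strip -/

/-- **Boundedness on closed sub-strips from a bounded datum.** A classical solution of the unforced system on
`ℝ³ × [0, T)` (`ν > 0`), Leray–Hopf from `u 0`, with `‖u(0, x)‖ ≤ B₀` for all `x`, is bounded on `[0, T₂] × ℝ³` for
every `T₂ < T`: on the early window `[0, t₁]`, `t₁ < c₀ν/B²` (`B = max B₀ 1`), by `2B`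
(`exists_earlyWindow_norm_le`); on `[t₁, T₂]` by interior boundedness (`LeraySupClock.exists_bound_window`).
[cite: LemarieRieusset2016, Thm. 5.1 (p. 103), §9.9 (p. 260) and proof of Thm. 14.5 (p. 512)] -/
theorem exists_bound_Icc_of_datum_bound {ν T : ℝ} (hν : 0 < ν) (hT : 0 < T)
    {u : ℝ → EuclideanSpace ℝ (Fin 3) → EuclideanSpace ℝ (Fin 3)} {p : ℝ → EuclideanSpace ℝ (Fin 3) → ℝ}
    (hcl : IsClassicalNSSolutionOn (Ico 0 T) ν 0 u p) (hLH : IsLerayHopfOn T ν 0 (u 0) u)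
    {B₀ : ℝ} (hB₀ : ∀ x, ‖u 0 x‖ ≤ B₀) {T₂ : ℝ} (hT₂ : T₂ < T) :
    ∃ M : ℝ, ∀ t ∈ Icc 0 T₂, ∀ x, ‖u t x‖ ≤ M := by
  obtain ⟨c₀, hc₀, hE⟩ := exists_earlyWindow_norm_le
  set B : ℝ := max B₀ 1 with hBdef
  have hB : 0 < B := lt_of_lt_of_le one_pos (le_max_right _ _)
  have hbd : ∀ x, ‖u 0 x‖ ≤ B := fun x => (hB₀ x).trans (le_max_left _ _)
  -- the early window `[0, t₁]`
  set t₁ : ℝ := min (c₀ * ν / B ^ 2 / 2) (T / 2) with ht₁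
  have hcB : 0 < c₀ * ν / B ^ 2 := by positivity
  have ht₁pos : 0 < t₁ := lt_min (by positivity) (by linarith)
  have ht₁T : t₁ < T := (min_le_right _ _).trans_lt (by linarith)
  have ht₁c : t₁ < c₀ * ν / B ^ 2 := (min_le_left _ _).trans_lt (by linarith)
  have hearly : ∀ t ∈ Icc 0 t₁, ∀ x, ‖u t x‖ ≤ 2 * B := fun t ht x =>
    hE ν T u p hν hT hcl hLH B hB hbd t ⟨ht.1, ht.2.trans_lt ht₁T⟩ (ht.2.trans_lt ht₁c) x
  -- beyond it, interior boundedness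
  obtain ⟨M₂, hM₂⟩ := exists_bound_window hν hT hcl hLH ht₁pos (T' := T₂) hT₂
  refine ⟨max (2 * B) M₂, fun t ht x => ?_⟩
  rcases le_or_gt t t₁ with h | h
  · exact (hearly t ⟨ht.1, h⟩ x).trans (le_max_left _ _)
  · exact (hM₂ t ⟨h.le, ht.2⟩ x).trans (le_max_right _ _)

/-! ## L28 with the datum clause -/

/-- **L28 — KATO'S CRITICAL FLOOR, INTERIOR AND AT THE DATUM, ONE CONSTANT.** There is an absolute `δ > 0`
(Kato's small-data constant, `kato_global_small_holds`) such that for every `ν > 0`, `T > 0` and every maximal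
smooth solution `(u, p)` of the unforced Navier–Stokes system on `ℝ³ × [0, T)` which is Leray–Hopf from `u 0`:
(i) `δ ν < ‖u(t)‖_{L³}` at EVERY `t ∈ (0, T)`; (ii) if the datum is bounded (`‖u(0, x)‖ ≤ B₀` for all `x`), also
`δ ν < ‖u(0)‖_{L³}`. Both by the continuation step `hasSmoothExtensionPast_of_kato_of_bound` — interior instants
restart by `LerayClock.isLerayHopfOn_translate` and are bounded forward by `LeraySupClock.exists_bound_window`; the
datum restarts trivially and is bounded forward by `exists_bound_Icc_of_datum_bound` — and maximality. THE FIRST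
TEST OF A CANDIDATE IS AT THE DATA LEVEL: a bounded finite-energy datum below Kato's threshold launches no
blow-up. [cite: Kato1984MathZ, Thms. 2 and 4] [cite: LemarieRieusset2016, Thm. 7.5 and Thm. 15.1] -/
theorem eLpNorm_three_floor' :
    ∃ δ : ℝ, 0 < δ ∧ ∀ (ν T : ℝ), 0 < ν → 0 < T →
      ∀ (u : ℝ → EuclideanSpace ℝ (Fin 3) → EuclideanSpace ℝ (Fin 3)) (p : ℝ → EuclideanSpace ℝ (Fin 3) → ℝ),
      IsMaximalSmoothSolution ν 0 u p T → IsLerayHopfOn T ν 0 (u 0) u →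
      (∀ t ∈ Ioo 0 T, ENNReal.ofReal (δ * ν) < eLpNorm (u t) 3 volume) ∧
      ((∃ B₀ : ℝ, ∀ x, ‖u 0 x‖ ≤ B₀) → ENNReal.ofReal (δ * ν) < eLpNorm (u 0) 3 volume) := by
  obtain ⟨δ, hδ, H⟩ := kato_global_small_holds
  -- the common core: a Kato-small slice at `t₀ ∈ [0, T)` which restarts and is bounded forward is absurd
  have core : ∀ (ν T : ℝ), 0 < ν → 0 < T →
      ∀ (u : ℝ → EuclideanSpace ℝ (Fin 3) → EuclideanSpace ℝ (Fin 3)) (p : ℝ → EuclideanSpace ℝ (Fin 3) → ℝ),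
      IsMaximalSmoothSolution ν 0 u p T → IsLerayHopfOn T ν 0 (u 0) u → ∀ t₀ ∈ Ico 0 T,
      (∀ T₂ ∈ Ioo t₀ T, IsLerayHopfOn (T₂ - t₀) ν 0 (u t₀) (fun s => u (s + t₀))) →
      (∀ T₂ ∈ Ioo t₀ T, ∃ M : ℝ, ∀ t ∈ Icc t₀ T₂, ∀ x, ‖u t x‖ ≤ M) →
      ENNReal.ofReal (δ * ν) < eLpNorm (u t₀) 3 volume := by
    intro ν T hν hT u p hmax hLH t₀ ht₀ hrestart hbd
    by_contra hle
    rw [not_lt] at hle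
    have hT₂ : (t₀ + T) / 2 ∈ Ioo t₀ T := ⟨by linarith [ht₀.2], by linarith [ht₀.2]⟩
    obtain ⟨M, hM⟩ := hbd _ hT₂
    have hu3 : MemLp (u t₀) 3 volume :=
      memLp_three_of_memLp_two_of_norm_le (hLH.memLp t₀ ⟨ht₀.1, ht₀.2.le⟩)
        (fun x => hM t₀ ⟨le_rfl, hT₂.1.le⟩ x)
    have hdiv : IsWeaklyDivFree (u t₀) := (hrestart _ hT₂).isWeaklyDivFree_datum (by linarith [hT₂.1])
    obtain ⟨v, hv, hvc, hv0, hvm, ⟨C, hC⟩, -⟩ := H ν hν (u t₀) hu3 hdiv hle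
    have hinf : ∀ s : ℝ, 0 < s → eLpNorm (v s) ∞ volume ≤ ENNReal.ofReal (C / Real.sqrt s) := by
      intro s hs
      have h := hC s hs
      have e : C * s ^ (-(1 / 2 : ℝ)) = C / Real.sqrt s := by
        rw [Real.rpow_neg hs.le, Real.sqrt_eq_rpow, ← div_eq_mul_inv]
      rwa [e] at h
    exact hmax.2 (hasSmoothExtensionPast_of_kato_of_bound hν hmax.1 hLH ht₀ hrestart hbd hv hvc hv0 hvm hinf)
  refine ⟨δ, hδ, fun ν T hν hT u p hmax hLH => ⟨fun t ht => ?_, fun ⟨B₀, hB₀⟩ => ?_⟩⟩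
  · -- interior instants
    exact core ν T hν hT u p hmax hLH t ⟨ht.1.le, ht.2⟩
      (fun T₂ hT₂ => isLerayHopfOn_translate hν hT hmax.1 hLH ht hT₂)
      (fun T₂ hT₂ => exists_bound_window hν hT hmax.1 hLH ht.1 (T' := T₂) hT₂.2)
  · -- the datum
    refine core ν T hν hT u p hmax hLH 0 ⟨le_rfl, hT⟩ (fun T₂ hT₂ => ?_) (fun T₂ hT₂ => ?_)
    · simpa only [sub_zero, add_zero] using hLH.of_le hT₂.2.le
    · exact exists_bound_Icc_of_datum_bound hν hT hmax.1 hLH hB₀ hT₂.2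

end Summit.NavierStokesRegularity.FluidComputer.CriticalDatumFloor

end
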